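import Summits.QuantumFields.YangMills.Theorems.LuscherReductionTwistedTraceScalingCovGradInjective
import HarnessLib

/-!
# Linearisation of the relative coordinate under an ARBITRARY small gauge transformation at a general slow variable: the mean of the gauge parameter drops out
# (lane A of S-BASE, crux `TwistedTraceScaling` stmt-QuantumFields-20203, C4 INNER; design note `pub/ym-fleet/ym-luscher-20007-p1/COARSE-DESIGN.md` §23.8 (N2))

`…GaugeActionCovariant` linearised `relLinkVec((orthoTube u w)^{P∘ξ})` for MEAN-ZERO `ξ`.  The Faddeev–Popov weight `N(U) = ∫ recordWeight(U^g) dg` is most conveniently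
evaluated over BASED gauge transformations (`g(0) = 1`; product Haar, gnomonic product chart `…GaugeGroupGnChart`), whose parameters are not mean-zero.  THIS FILE:
for ANY small `ξ` (`‖ξ_x‖∞ ≤ G ≤ 1/40`), balanced `w` (`‖w_e‖∞ ≤ ω ≤ 1/20`) and slow variable `u` with `|u⃗_k|∞ ≤ τ ≤ 1`:
★★ `norm_relLinkVec_gaugeTransform_orthoTube_sub_le'`: `‖relLinkVec((orthoTube u w)^{P∘ξ})_e − (w_e − (D_u(ξ − ξ̄))_e)‖∞ ≤ 11·(40(4G² + 2Gω) + 12τG)`, `ξ̄ = (1/N)Σ_x ξ_x` —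
the MEAN of the gauge parameter drops out of the linear part (it acts as a global colour rotation, second order on the relative coordinate; cf. `…RecordWeightConj`),
and the linear map is `ξ ↦ −D_u(ξ − ξ̄)`, nondegenerate on based fields (`ξ ↦ ξ − ξ̄` is injective on `{ξ(0) = 0}`).  Ingredients: the abstract polar-mean lemma
`norm_relLink_sub_lin_le` with the re-centred prediction `lin' = lin − (1 − Ad(u_k))ξ̄` (whose direction sums vanish for every `ξ`), `abs_adRot_sub_one_mulVec_le`.
HONEST FRAMING: finite-dimensional algebra for a stub of a child of the CONDITIONAL reduction route R2b1; no spectral claim; C4 OPEN; not a gap, not Clay.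
-/

set_option autoImplicit false

noncomputable section

open Real
open scoped BigOperators Matrix
open Literature.MathematicalPhysics.QuantumFieldTheory
open Literature.MathematicalPhysics.QuantumLattice

namespace Summit.QuantumFields.YangMills.Theorems.FemtoTransferGap.TwoLattice.ConstTube

open Summit.QuantumFields.YangMills.Theorems.FemtoTransferGap
open Literature.Algebra.EuclideanLattices (abs_apply_le_norm)

variable (L : ℕ) [NeZero L]

/-- The mean of a site field: `ξ̄ = (1/N) Σ_x ξ_x`. [folklore] -/
def siteMean (ξ : Site 3 L → Fin 3 → ℝ) : Fin 3 → ℝ := (Fintype.card (Site 3 L) : ℝ)⁻¹ • ∑ x : Site 3 L, ξ x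

/-- `Σ_x (ξ_x − ξ̄) = 0`. [folklore] -/
theorem sum_sub_siteMean (ξ : Site 3 L → Fin 3 → ℝ) : ∑ x : Site 3 L, (ξ x - siteMean L ξ) = 0 := by
  have hN : (Fintype.card (Site 3 L) : ℝ) ≠ 0 := by exact_mod_cast Fintype.card_ne_zero
  rw [Finset.sum_sub_distrib, Finset.sum_const, Finset.card_univ, siteMean, ← Nat.cast_smul_eq_nsmul ℝ, smul_smul, mul_inv_cancel₀ hN, one_smul, sub_self]

/-- `‖ξ̄‖∞ ≤ G` when every `‖ξ_x‖∞ ≤ G`. [folklore] -/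
theorem norm_siteMean_le {ξ : Site 3 L → Fin 3 → ℝ} {G : ℝ} (hG : ∀ x, ‖ξ x‖ ≤ G) : ‖siteMean L ξ‖ ≤ G := by
  have hN : (0 : ℝ) < Fintype.card (Site 3 L) := by exact_mod_cast Fintype.card_pos
  rw [siteMean, norm_smul, norm_inv, Real.norm_of_nonneg hN.le, inv_mul_le_iff₀ hN]
  calc ‖∑ x : Site 3 L, ξ x‖ ≤ ∑ x : Site 3 L, ‖ξ x‖ := norm_sum_le _ _
    _ ≤ ∑ _x : Site 3 L, G := Finset.sum_le_sum fun x _ => hG x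
    _ = Fintype.card (Site 3 L) * G := by rw [Finset.sum_const, Finset.card_univ, nsmul_eq_mul]

section Main

variable {L}
variable {u : GaugeConfig 3 1 SU2} {ξ : Site 3 L → Fin 3 → ℝ} {w : Edge 3 L → Fin 3 → ℝ} {G ω τ : ℝ}
  (hG : ∀ x, ‖ξ x‖ ≤ G) (hω : ∀ e, ‖w e‖ ≤ ω) (hG1 : G ≤ 1 / 40) (hω1 : ω ≤ 1 / 20)
  (hτ1 : τ ≤ 1) (hu : ∀ (k : Fin 3) (c : Fin 3), |vecPart (u (0, k)) c| ≤ τ)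

include hG hω hG1 hω1 hτ1 hu

/-- Per link, with the RE-CENTRED prediction `lin'_e = w_e + (ξ_x − ξ̄) − Ad(u_k)(ξ_y − ξ̄)`: `‖(covRel u ξ w e)⃗ − lin'_e‖∞ ≤ 40(4G² + 2Gω) + 12τG`. [folklore] -/
theorem norm_vecPart_covRel_sub_linear_le' (e : Edge 3 L) :
    ‖vecPart (covRel L u ξ w e) - (w e + (ξ e.1 - siteMean L ξ) - (adRot (u (0, e.2))).mulVec (ξ (e.1.shift e.2) - siteMean L ξ))‖ ≤
      40 * (4 * G ^ 2 + 2 * G * ω) + 12 * τ * G := by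
  have h1 := norm_vecPart_covRel_sub_linear_le hG hω hG1 hω1 (u := u) e
  have hτ0 : 0 ≤ τ := (abs_nonneg _).trans (hu 0 0)
  have hm : ‖((adRot (u (0, e.2)) - 1).mulVec (siteMean L ξ))‖ ≤ 12 * τ * G := by
    refine (pi_norm_le_iff_of_nonneg (by nlinarith [(norm_nonneg _).trans (hG 0)])).mpr fun a => ?_
    rw [Real.norm_eq_abs]
    exact (abs_adRot_sub_one_mulVec_le _ hτ1 (hu e.2) _ a).trans (mul_le_mul_of_nonneg_left (norm_siteMean_le L hG) (by positivity))
  have hdec : vecPart (covRel L u ξ w e) - (w e + (ξ e.1 - siteMean L ξ) - (adRot (u (0, e.2))).mulVec (ξ (e.1.shift e.2) - siteMean L ξ)) =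
      (vecPart (covRel L u ξ w e) - (w e + ξ e.1 - (adRot (u (0, e.2))).mulVec (ξ (e.1.shift e.2)))) - (adRot (u (0, e.2)) - 1).mulVec (siteMean L ξ) := by
    rw [Matrix.mulVec_sub, Matrix.sub_mulVec, Matrix.one_mulVec]; abel
  rw [hdec]
  exact (norm_sub_le _ _).trans (add_le_add h1 hm)

omit hG hω hG1 hω1 hτ1 hu in
/-- The re-centred predictions have vanishing direction sums — for EVERY `ξ`. [folklore] -/
theorem sum_covLin'_eq_zero (hbal : ∀ (k : Fin 3) (a : Fin 3), ∑ x : Site 3 L, w (x, k) a = 0) (k : Fin 3) :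
    ∑ x : Site 3 L, (w (x, k) + (ξ x - siteMean L ξ) - (adRot (u (0, k))).mulVec (ξ (x.shift k) - siteMean L ξ)) = 0 := by
  have hw0 : ∑ x : Site 3 L, w (x, k) = 0 := by
    funext a; rw [Finset.sum_apply, Pi.zero_apply]; exact hbal k a
  have hrot : ∑ x : Site 3 L, (adRot (u (0, k))).mulVec (ξ (x.shift k) - siteMean L ξ) = (adRot (u (0, k))).mulVec (∑ x : Site 3 L, (ξ (x.shift k) - siteMean L ξ)) := by
    simp_rw [← Matrix.mulVecLin_apply]; rw [map_sum]
  have hshift : ∑ x : Site 3 L, (ξ (x.shift k) - siteMean L ξ) = ∑ x : Site 3 L, (ξ x - siteMean L ξ) :=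
    sum_shift_eq L (fun x => ξ x - siteMean L ξ) k
  rw [Finset.sum_sub_distrib, Finset.sum_add_distrib, hw0, zero_add, hrot, hshift, sum_sub_siteMean, Matrix.mulVec_zero, sub_zero]

/-- ★★ **LINEARISATION FOR AN ARBITRARY SMALL GAUGE PARAMETER**: `‖relLinkVec((orthoTube u w)^{P∘ξ})_{e,·} − (w_e − (D_u(ξ − ξ̄))_e)‖∞ ≤ 11·(40(4G² + 2Gω) + 12τG)`.
[folklore] -/
theorem norm_relLinkVec_gaugeTransform_orthoTube_sub_le' (hbal : ∀ (k : Fin 3) (a : Fin 3), ∑ x : Site 3 L, w (x, k) a = 0) (e : Edge 3 L) :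
    ‖(fun a => relLinkVec L (gaugeTransform (fun x => chartSU2 (ξ x)) (orthoTube L u w)) (e, a)) - (w e - covGrad L u (fun x => ξ x - siteMean L ξ) e)‖ ≤
      11 * (40 * (4 * G ^ 2 + 2 * G * ω) + 12 * τ * G) := by
  have hξ1 : ∀ x, ∑ a, ξ x a ^ 2 ≤ 1 := fun x => by
    have h3 := sum_sq_le_three_norm_sq (ξ x)
    have hx : ‖ξ x‖ ≤ 1 / 40 := (hG x).trans hG1
    nlinarith [norm_nonneg (ξ x)]
  rw [gaugeTransform_orthoTube_eq L u ξ w hξ1, relLinkVec_mul_constLift L _ u (dirQuat_covRel_ne_zero hG hω hG1 hω1)]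
  have hfun : (fun a => relLinkVec L (covRel L u ξ w) (e, a)) = vecPart (covRel L u ξ w e * (polarMean L e.2 (covRel L u ξ w))⁻¹) := by
    funext a; rfl
  rw [hfun]
  have hlin' : w e - covGrad L u (fun x => ξ x - siteMean L ξ) e = w e + (ξ e.1 - siteMean L ξ) - (adRot (u (0, e.2))).mulVec (ξ (e.1.shift e.2) - siteMean L ξ) := by
    simp only [covGrad]; abel
  rw [hlin']
  exact norm_relLink_sub_lin_le (V := covRel L u ξ w)
    (lin := fun e => w e + (ξ e.1 - siteMean L ξ) - (adRot (u (0, e.2))).mulVec (ξ (e.1.shift e.2) - siteMean L ξ))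
    (ρ := 40 * (4 * G ^ 2 + 2 * G * ω) + 12 * τ * G) (norm_vecPart_covRel_sub_linear_le' hG hω hG1 hω1 hτ1 hu)
    (half_le_scalarPart_covRel hG hω hG1 hω1) (sum_covLin'_eq_zero hbal) e

end Main

end Summit.QuantumFields.YangMills.Theorems.FemtoTransferGap.TwoLattice.ConstTube

end
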